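/-
Copyright (c) 2026 the pub-hodgecm-mathlib formalisation cell (harness21).  Prover seat hodgecm-mathlib-K2E5-p04 (g3), HCML Track B «K2-LIT» (build stream 29),
h413 = `stmt-HodgeConjecture-24833`, line `K2_E3_EllipticInputs`, unit U12 «Characters», socket #11 road (11-SC), letter (SC-an), END-GAME MAP v5 (line lead
K2E3-p14 (g4) RULINGS #15 (R15-2) 2026-09-04T03:42:59Z «LETTER-NEUTRAL DOCKING»): piece (M5h‴) — THE (SC-an) ∃-DATUM AT `N = 3` MODULO AN ELLIPTIC ORBITAL WEIGHT
AT THE PLACE («ELL-WEIGHT», payable by road A = HC-14-ell OR by road FC = finite conjugation measure).  2026-09-04.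
-/
import Summits.HodgeConjecture.HodgeConjecture.Theorems.K2E3SupercuspidalTruncatedCharAnalyticOfHC14Ell  -- ★ (M5h) FILE B p857093 (this seat): §1 `sigSCan_datum_of_compactSpace` (letter-free), FILE A kit ★ p857048, ★ [M6′] A∕B∕C, ★ [M6], ★ p856355
import HarnessLib

/-!
# h413 ∕ Track B «K2-LIT», line `K2_E3_EllipticInputs`, unit U12, road (11-SC), letter (SC-an) — (M5h‴): THE (SC-an) DATUM FOR A SUPERCUSPIDAL `SmoothIrrep` OF
# `U₃(H)(L⁺_v)` AT A NON-SPLIT PLACE, MODULO A LOCALLY INTEGRABLE ELLIPTIC ORBITAL WEIGHT AT THE PLACE («ELL-WEIGHT», letter-neutral docking)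
# (Harish-Chandra 1970, Part VII §3 Theorem 16 and its proof pp. 70–73; Theorems 14, 15, 18–20)

Cell `pub/hodgecm-mathlib`, crux H413 = `stmt-HodgeConjecture-24833`, route of record `HCCMUnconditional`; chair K2-lead (g0), dealer K2E3-plan (g3), (SC-an) line lead K2E3-p14 (g4).
RULINGS #15 (R15-1)–(R15-2): the consumer ★ p856355 `sigSCan_datum_of_bricks` needs on the elliptic-regular set only `∫ ‖θ(x g x⁻¹)‖ dx ≤ W g` a.e. with `W ∈ L¹_loc` — NOT
Harish-Chandra's sup-bound.  THIS FILE therefore re-binds ★ p857093 ∕ ★ p857125's head to the LETTER-NEUTRAL hypothesis «ELL-WEIGHT at the place»: for `U_w := U(σ_w, Φ₃)(L_w)`,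
every Haar `μ'` and every compact `S ⊆ U_w` there is `W_E : U_w → ℝ`, `W_E ∈ L¹_loc(μ')`, `W_E ≥ 0`, with `∫⁻ x, Θ (x γ x⁻¹) ∂μ' ≤ W_E(γ) · Mb` for every regular `γ` with compact
centraliser and every Borel `Θ ≤ Mb` vanishing off `S` — ∀-closed with cand v2's binder kinds (`(L') [Field] [NumberField] [IsCMField] {v'} (w') (hw') [MeasurableSpace]
[BorelSpace] (μ') [IsHaarMeasure] {S} (hS)`), so that either payer docks BARE: `ellWeightPlace_of_hc14EllPlace` (road A: `W_E := C·T⁻¹`, ★ FILE A §4) or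
`ellWeightPlace_of_finConj` (road FC, K2E3-p14 (g4): `W_E := ∫⁻ β(x · x⁻¹)` for a Urysohn bump `β ≥ 1_S`).  THEOREMS ONLY (no `def`, no `instance`, no `notation`, no `sorry`);
lane `--supports stmt-HodgeConjecture-24833 --as helper`, count-neutral.

PROOF = ★ p857093's §2 re-run with the weight `W := W_M ∘ e`, **`W_M(m) = K₀·(h(m)+1)·q^{h(m)}·T(m)⁻¹(1+|log T(m)|) + Mb·W_E(m)`** (`h = Ω_M.find`, `K₀ = C·Mb·A₀`, `W_E` from
`hEW L w hw (μ.map e) (Ω_M.isCompact m_θ)`): locally integrable by ★ FILE A + `hEW` (sum), the first summand dominating the split shell bound (★ FILE A §1, `τ = ⌈log_q T⁻¹⌉₊`,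
`λ_min ≤ 4τ + 10h` ★ (M5e-2)) and the second the elliptic full-orbital bound; ★ p856355 concludes (§1); `H_w` ANISOTROPIC ⇒ ★ letter-free `sigSCan_datum_of_compactSpace`; §2 dispatches
by ★ (f2) `isotropic_or_anisotropic`.

HONEST LABEL.  HC_CM is proved only modulo the 7 printed citations (2 remaining named inputs: hLiu418 = `stmt-HodgeConjecture-24832`, h413 = `stmt-HodgeConjecture-24833`)
until rung 0 closes; count-neutral helper: after this file the (SC-an) letter `sig_K2E3SupercuspidalTruncatedCharAnalytic` at `N = 3` is ★ MODULO EXACTLY ONE named input,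
«ELL-WEIGHT at the place» (implied by «HC-14-ell» = Harish-Chandra's Theorem 14, road A, and by the finite-conjugation-measure statement (FC), road FC), which is NOT proved here.

## References
* [HarishChandra1970] Harish-Chandra (notes by G. van Dijk), *Harmonic Analysis on Reductive p-adic Groups*, LNM 162 (1970), Part VI §8 Theorem 14 p. 60; Part VII §1 Thm. 15
  p. 63, §2 Theorems 18–20 pp. 69–70, §3 Theorem 16 p. 67 and pp. 70–73.  * [Folland1995] G. B. Folland, *A Course in Abstract Harmonic Analysis* (1995), §2.4.
* [Rogawski1990] J. D. Rogawski, *Automorphic Representations of Unitary Groups in Three Variables*, Ann. of Math. Stud. 123 (1990), §4.9 p. 54, §7.3 p. 97, §12.2 p. 173,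
  §12.5 p. 182, §14.2 p. 232.
* [BasuPollackRoy2006] S. Basu, R. Pollack, M.-F. Roy, *Algorithms in Real Algebraic Geometry*, 2nd ed. (2006), Prop. 4.3.
-/

set_option autoImplicit false
-- the mandated namespace repeats the single-problem summit's segment (`HodgeConjecture.HodgeConjecture`)
set_option linter.dupNamespace false

noncomputable section

open MeasureTheory Measure Set Filter Topology NumberField IsDedekindDomain
open scoped NNReal ENNReal Pointwise Matrix MatrixGroups WithZero
open ValuativeRel
open Literature.NumberTheory.Automorphic Literature.NumberTheory.Automorphic.UnitaryGroup Literature.NumberTheory.Rogawski1990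
open Literature.NumberTheory.GaloisRepresentations Literature.NumberTheory.GaloisRepresentations.IsNonarchimedeanLocalField

namespace Summit.HodgeConjecture.HodgeConjecture.Cruxes.H413.K2E3SupercuspidalTruncatedCharAnalyticOfEllWeightPlace

variable (L : Type) [Field L] [NumberField L] [IsCMField L] (H : Matrix (Fin 3) (Fin 3) L)

/-! ## §1 The isotropic engine along a field model `e`, modulo «ELL-WEIGHT» AT THE PLACE -/
set_option maxHeartbeats 1600000 in -- long statement (the ∀-closed letter as a binder) and a long assembly on the CM ∕ one-place carriers
/-- **(SC-an) DATUM ALONG A FIELD MODEL `e : G ≃ₜ* U(σ_w, Φ₃)(L_w)`, MODULO «ELL-WEIGHT» AT THE PLACE** (isotropic `H_w`; `e` from ★ (f2)): ★ [M6′] FILE B's `Ω R m_θ F Bset` with the height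
balls ★ p856390; the weight `W := W_M ∘ e`, `W_M(m) = K₀·(h(m)+1)·q^{h(m)}·T(m)⁻¹(1+|log T(m)|) + Mb·W_E(m)`, locally integrable (★ FILE A + `hEW`), the first summand
dominating the split shell bound (★ FILE A §1, `τ = ⌈log_q T⁻¹⌉₊`, `λ_min ≤ 4τ + 10h`), the second the elliptic full-orbital bound (`hEW` at `S := Ω_M m_θ`, `Θ := ‖θ_M‖ₑ`,
`Mb := ‖θ‖_∞`); ★ p856355 concludes.
[cite: HarishChandra1970, Part VII §3 Theorem 16 p. 67, pp. 70–73; Part VI §8 Theorem 14 p. 60; Part VII §1 Thm. 15 p. 63] [cite: Rogawski1990, §4.9 p. 54, §7.3 p. 97, §12.5 p. 182] -/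
theorem sigSCan_datum_of_ellWeightPlace_of_fieldModel
    (hEW : ∀ (L' : Type) [Field L'] [NumberField L'] [IsCMField L'] {v' : HeightOneSpectrum (𝓞 ↥(maximalRealSubfield L'))}
      (w' : UnitaryGroup.PlacesOver L' v') (hw' : IsCMField.complexConj L' • w'.1 = w'.1)
      [MeasurableSpace ↥(unitaryGroupOfForm (galAdicCompletionMap (L := L') (IsCMField.complexConj L') hw') ((StdForm.antidiagonal 3).over (w'.1.adicCompletion L')))]
      [BorelSpace ↥(unitaryGroupOfForm (galAdicCompletionMap (L := L') (IsCMField.complexConj L') hw') ((StdForm.antidiagonal 3).over (w'.1.adicCompletion L')))]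
      (μ' : Measure ↥(unitaryGroupOfForm (galAdicCompletionMap (L := L') (IsCMField.complexConj L') hw') ((StdForm.antidiagonal 3).over (w'.1.adicCompletion L')))) [μ'.IsHaarMeasure]
      {S : Set ↥(unitaryGroupOfForm (galAdicCompletionMap (L := L') (IsCMField.complexConj L') hw') ((StdForm.antidiagonal 3).over (w'.1.adicCompletion L')))} (_ : IsCompact S),
      ∃ W_E : ↥(unitaryGroupOfForm (galAdicCompletionMap (L := L') (IsCMField.complexConj L') hw') ((StdForm.antidiagonal 3).over (w'.1.adicCompletion L'))) → ℝ,
        LocallyIntegrable W_E μ' ∧ (∀ g, 0 ≤ W_E g) ∧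
        ∀ γ : ↥(unitaryGroupOfForm (galAdicCompletionMap (L := L') (IsCMField.complexConj L') hw') ((StdForm.antidiagonal 3).over (w'.1.adicCompletion L'))),
          IsRegularElt (γ : GL (Fin 3) (w'.1.adicCompletion L')) →
          IsCompact ((Subgroup.centralizer ({γ} : Set ↥(unitaryGroupOfForm (galAdicCompletionMap (L := L') (IsCMField.complexConj L') hw') ((StdForm.antidiagonal 3).over (w'.1.adicCompletion L'))))) :
              Set ↥(unitaryGroupOfForm (galAdicCompletionMap (L := L') (IsCMField.complexConj L') hw') ((StdForm.antidiagonal 3).over (w'.1.adicCompletion L')))) →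
            ∀ Θ : ↥(unitaryGroupOfForm (galAdicCompletionMap (L := L') (IsCMField.complexConj L') hw') ((StdForm.antidiagonal 3).over (w'.1.adicCompletion L'))) → ℝ≥0∞,
              Measurable Θ → (∀ g, Θ g ≠ 0 → g ∈ S) → ∀ Mb : ℝ≥0∞, (∀ g, Θ g ≤ Mb) →
                ∫⁻ x, Θ (x * γ * x⁻¹) ∂μ' ≤ ENNReal.ofReal (W_E γ) * Mb)
    (hH : (H.map (cmConjRingHom L))ᵀ = H) (hdet : H.det ≠ 0)
    (v : HeightOneSpectrum (𝓞 ↥(maximalRealSubfield L))) (hns : ∀ w : PlacesOver L v, IsCMField.complexConj L • w.1 = w.1)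
    (w : PlacesOver L v) (hw : IsCMField.complexConj L • w.1 = w.1)
    [MeasurableSpace ((UnitaryGroup.cmDatum L 3 H).Local v)] [BorelSpace ((UnitaryGroup.cmDatum L 3 H).Local v)]
    (μ : Measure ((UnitaryGroup.cmDatum L 3 H).Local v)) [μ.IsHaarMeasure]
    (e : (UnitaryGroup.cmDatum L 3 H).Local v ≃ₜ*
      ↥(unitaryGroupOfForm (galAdicCompletionMap (L := L) (IsCMField.complexConj L) hw) ((StdForm.antidiagonal 3).over (w.1.adicCompletion L))))
    (r : SmoothIrrep ((UnitaryGroup.cmDatum L 3 H).Local v)) (hsc : r.ρ.IsSupercuspidal)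
    (B : r.V →ₗ⋆[ℂ] r.V →ₗ[ℂ] ℂ) (hBinv : ∀ (g : (UnitaryGroup.cmDatum L 3 H).Local v) (x y : r.V), B (r.ρ g x) (r.ρ g y) = B x y) (v₁ : r.V) :
    ∃ (Ω' : CompactExhaustion ((UnitaryGroup.cmDatum L 3 H).Local v))
      (F' : (UnitaryGroup.cmDatum L 3 H).Local v → ℂ) (M : (UnitaryGroup.cmDatum L 3 H).Local v → ℝ),
      (∀ᵐ g ∂μ, ¬ (IsRegularElt (g.val : GL (Fin 3) (UnitaryGroup.LocalRing L v)) ∧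
          IsCompact ((Subgroup.centralizer ({g} : Set ((UnitaryGroup.cmDatum L 3 H).Local v))) : Set ((UnitaryGroup.cmDatum L 3 H).Local v))) →
        Tendsto (fun n => ∫ x in Ω' n, B v₁ (r.ρ (x * g * x⁻¹) v₁) ∂μ) atTop (𝓝 (F' g))) ∧
      (∀ n : ℕ, ∀ᵐ g ∂μ, ‖∫ x in Ω' n, B v₁ (r.ρ (x * g * x⁻¹) v₁) ∂μ‖ ≤ M g) ∧
      LocallyIntegrable M μ := by
  letI iM : MeasurableSpace ↥(unitaryGroupOfForm (galAdicCompletionMap (L := L) (IsCMField.complexConj L) hw) ((StdForm.antidiagonal 3).over (w.1.adicCompletion L))) :=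
    borel _
  haveI : BorelSpace ↥(unitaryGroupOfForm (galAdicCompletionMap (L := L) (IsCMField.complexConj L) hw) ((StdForm.antidiagonal 3).over (w.1.adicCompletion L))) := ⟨rfl⟩
  haveI : (μ.map e).IsHaarMeasure := ContinuousMulEquiv.isHaarMeasure_map μ e
  haveI : CharZero (w.1.adicCompletion L) := charZero_of_injective_algebraMap (algebraMap L (w.1.adicCompletion L)).injective
  haveI : SecondCountableTopology ↥(unitaryGroupOfForm (galAdicCompletionMap (L := L) (IsCMField.complexConj L) hw) ((StdForm.antidiagonal 3).over (w.1.adicCompletion L))) :=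
    K2E3SupercuspModelFrameAtPlace.secondCountableTopology_unitaryGroupOfForm_adicCompletion L w _ _
  haveI : LocallyCompactSpace ↥(unitaryGroupOfForm (galAdicCompletionMap (L := L) (IsCMField.complexConj L) hw) ((StdForm.antidiagonal 3).over (w.1.adicCompletion L))) :=
    K2E3SupercuspModelFrameAtPlace.locallyCompactSpace_unitaryGroupOfForm_adicCompletion L w hw _
  have hσc : Continuous (galAdicCompletionMap (L := L) (IsCMField.complexConj L) hw) := continuous_galAdicCompletionMap L (IsCMField.complexConj L) hw
  have hσv : ∀ x, Valued.v (galAdicCompletionMap (L := L) (IsCMField.complexConj L) hw x) = Valued.v x :=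
    fun x => valued_galAdicCompletionMap (L := L) (IsCMField.complexConj L) hw x
  haveI := compactSpace_integer_adicCompletion L w.1
  obtain ⟨ϖ, hϖ⟩ := exists_v_eq_exp_neg_one_adicCompletion (E := L) w.1
  obtain ⟨ΩM, hmem, -, hinv, hmul, -⟩ := K2E3HeightBallExhaustion.exists_heightBall_compactExhaustion
    (galAdicCompletionMap (L := L) (IsCMField.complexConj L) hw) ((StdForm.antidiagonal 3).over (w.1.adicCompletion L)) hσc hϖ
  obtain ⟨Ω, R, mθ, F, Bset, -, -, hBsetc, hlim, hcanc, hθ, hdat, hregae, hballR, hballER⟩ :=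
    K2E3SupercuspidalTruncatedCharLimCancExplicit.explicit_limit_localisation_and_hball_reduction L H w hw μ e ΩM hϖ hmem hinv hmul r.ρ r.isSmooth hsc B hBinv v₁ v₁
  -- the model coefficient `θ_M`: continuous, supported in `Ω_M m_θ`, bounded by `Mb`
  have hθMc : Continuous fun m' : ↥(unitaryGroupOfForm (galAdicCompletionMap (L := L) (IsCMField.complexConj L) hw) ((StdForm.antidiagonal 3).over (w.1.adicCompletion L))) =>
      B v₁ (r.ρ (e.symm m') v₁) := (Representation.continuous_sesqForm_apply_apply (r.isSmooth v₁) v₁).comp e.symm.continuous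
  have hθMcs : HasCompactSupport fun m' : ↥(unitaryGroupOfForm (galAdicCompletionMap (L := L) (IsCMField.complexConj L) hw)
      ((StdForm.antidiagonal 3).over (w.1.adicCompletion L))) => B v₁ (r.ρ (e.symm m') v₁) :=
    HasCompactSupport.intro (ΩM.isCompact mθ) fun m' hm' => not_not.1 fun h => hm' (hθ m' h)
  obtain ⟨M₀, hM₀⟩ := hθMcs.exists_bound_of_continuous hθMc
  have hMb : ∀ m' : ↥(unitaryGroupOfForm (galAdicCompletionMap (L := L) (IsCMField.complexConj L) hw) ((StdForm.antidiagonal 3).over (w.1.adicCompletion L))),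
      ‖B v₁ (r.ρ (e.symm m') v₁)‖₊ ≤ Real.toNNReal M₀ := fun m' => by
    rw [← NNReal.coe_le_coe, coe_nnnorm]
    exact (hM₀ m').trans (Real.le_coe_toNNReal M₀)
  -- the token as an opaque function, its positivity at regular elements
  obtain ⟨T, hT⟩ : ∃ T : ↥(unitaryGroupOfForm (galAdicCompletionMap (L := L) (IsCMField.complexConj L) hw) ((StdForm.antidiagonal 3).over (w.1.adicCompletion L))) → ℝ≥0,
      ∀ m', T m' = NNReal.sqrt (NNReal.sqrt
        (normAbs (w.1.adicCompletion L) (((m' : GL (Fin 3) (w.1.adicCompletion L)) : Matrix (Fin 3) (Fin 3) (w.1.adicCompletion L))).charpoly.discr *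
          (normAbs (w.1.adicCompletion L) (((m' : GL (Fin 3) (w.1.adicCompletion L)) : Matrix (Fin 3) (Fin 3) (w.1.adicCompletion L))).det ^ 2)⁻¹)) := ⟨_, fun _ => rfl⟩
  have hT0 : ∀ m' : ↥(unitaryGroupOfForm (galAdicCompletionMap (L := L) (IsCMField.complexConj L) hw) ((StdForm.antidiagonal 3).over (w.1.adicCompletion L))),
      IsRegularElt (m' : GL (Fin 3) (w.1.adicCompletion L)) → T m' ≠ 0 := fun m' hreg => by
    have hdisc : (((m' : GL (Fin 3) (w.1.adicCompletion L)) : Matrix (Fin 3) (Fin 3) (w.1.adicCompletion L))).charpoly.discr ≠ 0 :=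
      (Literature.Algebra.Polynomial.DiscriminantSignRealRoots.discr_ne_zero_iff_separable
        (by rw [Matrix.charpoly_degree_eq_dim, Fintype.card_fin]; exact_mod_cast (by norm_num : (0 : ℕ) < 3))).2 hreg
    have hdet' : (((m' : GL (Fin 3) (w.1.adicCompletion L)) : Matrix (Fin 3) (Fin 3) (w.1.adicCompletion L))).det ≠ 0 := by
      have h := (Matrix.GeneralLinearGroup.det (m' : GL (Fin 3) (w.1.adicCompletion L))).ne_zero
      rwa [Matrix.GeneralLinearGroup.val_det_apply] at h
    rw [hT]
    intro h
    have h' := NNReal.sqrt_eq_zero.1 (NNReal.sqrt_eq_zero.1 h)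
    exact mul_ne_zero ((map_ne_zero _).2 hdisc) (inv_ne_zero (pow_ne_zero 2 ((map_ne_zero _).2 hdet'))) h'
  -- the split constant (★ FILE A §1) and the elliptic weight `W_E` (the HYPOTHESIS at `S := Ω_M m_θ`)
  obtain ⟨C, hC⟩ := K2E3SupercuspidalTruncatedCharWeightKit.exists_const_integral_heightBall_norm_conj_le_shell_place L w hw
    (J := (StdForm.antidiagonal 3).over (w.1.adicCompletion L)) rfl (μ.map e) ΩM hϖ hmem hinv hmul mθ (E := ℂ)
  obtain ⟨WE, hWEli, hWE0, hWE⟩ := hEW L w hw (μ.map e) (ΩM.isCompact mθ)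
  -- `q`, `log q`, the constants `A₀`, `K₀` and the weight `W_M`
  have hq1 : (1 : ℝ) < ((residueFieldCard (w.1.adicCompletion L) : ℝ≥0) : ℝ) := by exact_mod_cast one_lt_residueFieldCard_nnreal (F := w.1.adicCompletion L)
  have hlogq : 0 < Real.log ((residueFieldCard (w.1.adicCompletion L) : ℝ≥0) : ℝ) := Real.log_pos hq1
  set A₀ : ℝ := 24 * (mθ : ℝ) + 579 + 160 / Real.log ((residueFieldCard (w.1.adicCompletion L) : ℝ≥0) : ℝ) with hA₀
  have hA₀0 : 0 ≤ A₀ := by positivity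
  set K₀ : ℝ := (C : ℝ) * (Real.toNNReal M₀ : ℝ) * A₀ with hK₀
  have hCM0 : 0 ≤ (C : ℝ) * (Real.toNNReal M₀ : ℝ) := mul_nonneg C.2 (Real.toNNReal M₀).2
  have hK₀0 : 0 ≤ K₀ := mul_nonneg hCM0 hA₀0
  have hK₀ge' : (C : ℝ) * (Real.toNNReal M₀ : ℝ) * A₀ ≤ K₀ := hK₀.symm.le
  set W_M : ↥(unitaryGroupOfForm (galAdicCompletionMap (L := L) (IsCMField.complexConj L) hw) ((StdForm.antidiagonal 3).over (w.1.adicCompletion L))) → ℝ :=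
    fun m' => K₀ * ((ΩM.find m' : ℝ) + 1) * ((residueFieldCard (w.1.adicCompletion L) : ℝ≥0) : ℝ) ^ (ΩM.find m') *
      (((T m' : ℝ))⁻¹ * (1 + |Real.log (T m' : ℝ)|) ^ 1) + (Real.toNNReal M₀ : ℝ) * WE m' with hW_M
  -- `W_M ∈ L¹_loc(M, e_* μ)` (★ FILE A §4–§5 for the split summand, `hEW` for the elliptic one), transported to `G`
  have hf := K2E3SupercuspidalTruncatedCharWeightKit.locallyIntegrable_inv_token_mul_log_pow L w hw (J := (StdForm.antidiagonal 3).over (w.1.adicCompletion L)) rfl (μ.map e) 1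
  simp only [← hT] at hf
  have hWM : LocallyIntegrable W_M (μ.map e) := by
    have h := (K2E3SupercuspidalTruncatedCharWeightKit.locallyIntegrable_heightWeight (μ.map e) ΩM hf hK₀0 hq1.le).add (hWEli.smul (Real.toNNReal M₀ : ℝ))
    rw [Pi.add_def, Pi.smul_def] at h
    simpa only [hW_M, smul_eq_mul] using h
  have hcoe : (⇑e.toHomeomorph : (UnitaryGroup.cmDatum L 3 H).Local v → _) = ⇑e := rfl
  have hW : LocallyIntegrable (fun g : (UnitaryGroup.cmDatum L 3 H).Local v => W_M (e g)) μ := by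
    have h := (locallyIntegrable_map_homeomorph (μ := μ) e.toHomeomorph (f := W_M)).1 (by rw [hcoe]; exact hWM)
    rw [hcoe] at h
    exact h
  -- the split summand of `W_M` is nonnegative
  have hWMpos : ∀ m', (0 : ℝ) ≤ K₀ * ((ΩM.find m' : ℝ) + 1) * ((residueFieldCard (w.1.adicCompletion L) : ℝ≥0) : ℝ) ^ (ΩM.find m') *
      (((T m' : ℝ))⁻¹ * (1 + |Real.log (T m' : ℝ)|) ^ 1) := fun m' =>
    mul_nonneg (mul_nonneg (mul_nonneg hK₀0 (by positivity)) (pow_nonneg (zero_le_one.trans hq1.le) _))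
      (mul_nonneg (inv_nonneg.2 (T m').2) (pow_nonneg (by positivity) _))
  -- THE ELLIPTIC BOUND from «ELL-WEIGHT»: for `e g` regular with compact `Z_M(e g)`, the full orbital integral of `‖θ_M‖` is finite and `≤ Mb·W_E(e g) ≤ W_M (e g)`
  have hell : ∀ g : (UnitaryGroup.cmDatum L 3 H).Local v,
      IsRegularElt ((e g : ↥(unitaryGroupOfForm (galAdicCompletionMap (L := L) (IsCMField.complexConj L) hw) ((StdForm.antidiagonal 3).over (w.1.adicCompletion L)))) :
        GL (Fin 3) (w.1.adicCompletion L)) →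
      IsCompact ((Subgroup.centralizer ({e g} : Set ↥(unitaryGroupOfForm (galAdicCompletionMap (L := L) (IsCMField.complexConj L) hw) ((StdForm.antidiagonal 3).over (w.1.adicCompletion L))))) :
        Set ↥(unitaryGroupOfForm (galAdicCompletionMap (L := L) (IsCMField.complexConj L) hw) ((StdForm.antidiagonal 3).over (w.1.adicCompletion L)))) →
      Integrable (fun x' : ↥(unitaryGroupOfForm (galAdicCompletionMap (L := L) (IsCMField.complexConj L) hw) ((StdForm.antidiagonal 3).over (w.1.adicCompletion L))) =>
        B v₁ (r.ρ (e.symm (x' * e g * x'⁻¹)) v₁)) (μ.map e) ∧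
      ∫ x', ‖B v₁ (r.ρ (e.symm (x' * e g * x'⁻¹)) v₁)‖ ∂(μ.map e) ≤ W_M (e g) := by
    intro g hreg hZM
    -- the hypothesis at `Θ := ‖θ_M‖ₑ`, `γ := e g`, `Mb := ‖θ‖_∞`
    have hL := hWE (e g) hreg hZM (fun m' => (‖B v₁ (r.ρ (e.symm m') v₁)‖₊ : ℝ≥0∞)) (measurable_coe_nnreal_ennreal.comp hθMc.nnnorm.measurable)
      (fun m' hm' => hθ m' fun h0 => hm' (by rw [h0, nnnorm_zero, ENNReal.coe_zero])) (Real.toNNReal M₀ : ℝ≥0∞) (fun m' => ENNReal.coe_le_coe.2 (hMb m'))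
    have htop : ENNReal.ofReal (WE (e g)) * ((Real.toNNReal M₀ : ℝ≥0) : ℝ≥0∞) ≠ ⊤ := ENNReal.mul_ne_top ENNReal.ofReal_ne_top ENNReal.coe_ne_top
    have hItop : ∫⁻ x', (‖B v₁ (r.ρ (e.symm (x' * e g * x'⁻¹)) v₁)‖₊ : ℝ≥0∞) ∂(μ.map e) < ∞ := lt_of_le_of_lt hL htop.lt_top
    have hcont : Continuous fun x' : ↥(unitaryGroupOfForm (galAdicCompletionMap (L := L) (IsCMField.complexConj L) hw) ((StdForm.antidiagonal 3).over (w.1.adicCompletion L))) =>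
        B v₁ (r.ρ (e.symm (x' * e g * x'⁻¹)) v₁) := hθMc.comp ((continuous_id.mul continuous_const).mul continuous_inv)
    have hint : Integrable (fun x' : ↥(unitaryGroupOfForm (galAdicCompletionMap (L := L) (IsCMField.complexConj L) hw) ((StdForm.antidiagonal 3).over (w.1.adicCompletion L))) =>
        B v₁ (r.ρ (e.symm (x' * e g * x'⁻¹)) v₁)) (μ.map e) := ⟨hcont.aestronglyMeasurable, hItop⟩
    refine ⟨hint, ?_⟩
    rw [integral_norm_eq_lintegral_enorm hcont.aestronglyMeasurable]
    have hle : (∫⁻ x', ‖B v₁ (r.ρ (e.symm (x' * e g * x'⁻¹)) v₁)‖ₑ ∂(μ.map e)).toReal ≤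
        (ENNReal.ofReal (WE (e g)) * ((Real.toNNReal M₀ : ℝ≥0) : ℝ≥0∞)).toReal := ENNReal.toReal_mono htop hL
    refine hle.trans ?_
    rw [ENNReal.toReal_mul, ENNReal.toReal_ofReal (hWE0 _), ENNReal.coe_toReal, mul_comm]
    calc (Real.toNNReal M₀ : ℝ) * WE (e g)
        ≤ K₀ * ((ΩM.find (e g) : ℝ) + 1) * ((residueFieldCard (w.1.adicCompletion L) : ℝ≥0) : ℝ) ^ (ΩM.find (e g)) *
            (((T (e g) : ℝ))⁻¹ * (1 + |Real.log (T (e g) : ℝ)|) ^ 1) + (Real.toNNReal M₀ : ℝ) * WE (e g) := le_add_of_nonneg_left (hWMpos (e g))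
      _ = W_M (e g) := by rw [hW_M]
  -- THE SPLIT BOUND at the exported datum (★ FILE A §1, shell index ★ FILE A §2, depth ★ (M5e-2))
  have hsplit : ∀ g : (UnitaryGroup.cmDatum L 3 H).Local v,
      IsRegularElt ((e g : ↥(unitaryGroupOfForm (galAdicCompletionMap (L := L) (IsCMField.complexConj L) hw) ((StdForm.antidiagonal 3).over (w.1.adicCompletion L)))) :
        GL (Fin 3) (w.1.adicCompletion L)) →
      ¬ IsCompact ((Subgroup.centralizer ({g} : Set ((UnitaryGroup.cmDatum L 3 H).Local v))) : Set ((UnitaryGroup.cmDatum L 3 H).Local v)) →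
      ∫ x' in ΩM (R g), ‖B v₁ (r.ρ (e.symm (x' * e g * x'⁻¹)) v₁)‖ ∂(μ.map e) ≤ W_M (e g) := by
    intro g hreg hZ
    obtain ⟨t, y₀, d, lam, mg, hd, -, -, hlam_min, hgm, hmg_min, -, hgy, hR⟩ := hdat g hreg hZ
    have hmg : mg = ΩM.find (e g) := le_antisymm (hmg_min _ (ΩM.mem_find _)) (ΩM.mem_iff_find_le.1 hgm)
    subst hmg
    have hTg := hT0 (e g) hreg
    obtain ⟨τ, hτ, hτle⟩ := K2E3SupercuspidalTruncatedCharWeightKit.exists_shellIndex hϖ (pos_iff_ne_zero.2 hTg)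
    rw [hT] at hτ
    have htT : t ∈ torusU (galAdicCompletionMap (L := L) (IsCMField.complexConj L) hw) ((StdForm.antidiagonal 3).over (w.1.adicCompletion L)) :=
      (mem_torusU_iff t).2 ⟨d, hd⟩
    -- depth on the shell: `λ_min ≤ 4τ + 10 h`
    have hgt : y₀ * t * y₀⁻¹ ∈ ΩM (ΩM.find (e g)) := by rw [← hgy]; exact hgm
    have hdm := fun i => (K2E3SupercuspBallBoundSplitAssembly.v_pow_mul_torus_le_one_of_conj_mem (galAdicCompletionMap (L := L) (IsCMField.complexConj L) hw) hσv rfl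
      hϖ ΩM hmem hd hgt i).1
    have hdm' := fun i => (K2E3SupercuspBallBoundSplitAssembly.v_pow_mul_torus_le_one_of_conj_mem (galAdicCompletionMap (L := L) (IsCMField.complexConj L) hw) hσv rfl
      hϖ ΩM hmem hd hgt i).2
    have hcoe' : ((e g : ↥(unitaryGroupOfForm (galAdicCompletionMap (L := L) (IsCMField.complexConj L) hw) ((StdForm.antidiagonal 3).over (w.1.adicCompletion L)))) :
        GL (Fin 3) (w.1.adicCompletion L)) =
        (y₀ : GL (Fin 3) (w.1.adicCompletion L)) * (glDiagonal 3 (w.1.adicCompletion L) d : GL (Fin 3) (w.1.adicCompletion L)) * (y₀ : GL (Fin 3) (w.1.adicCompletion L))⁻¹ := by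
      rw [hgy, hd]; rfl
    have hchar : ((((e g : ↥(unitaryGroupOfForm (galAdicCompletionMap (L := L) (IsCMField.complexConj L) hw) ((StdForm.antidiagonal 3).over (w.1.adicCompletion L)))) :
        GL (Fin 3) (w.1.adicCompletion L)) : Matrix (Fin 3) (Fin 3) (w.1.adicCompletion L))).charpoly =
        (((glDiagonal 3 (w.1.adicCompletion L) d : GL (Fin 3) (w.1.adicCompletion L)) : Matrix (Fin 3) (Fin 3) (w.1.adicCompletion L))).charpoly := by
      rw [hcoe', Units.val_mul, Units.val_mul, Matrix.coe_units_inv]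
      exact Matrix.charpoly_units_conj (y₀ : GL (Fin 3) (w.1.adicCompletion L)) _
    have hdet' : ((((e g : ↥(unitaryGroupOfForm (galAdicCompletionMap (L := L) (IsCMField.complexConj L) hw) ((StdForm.antidiagonal 3).over (w.1.adicCompletion L)))) :
        GL (Fin 3) (w.1.adicCompletion L)) : Matrix (Fin 3) (Fin 3) (w.1.adicCompletion L))).det =
        (((glDiagonal 3 (w.1.adicCompletion L) d : GL (Fin 3) (w.1.adicCompletion L)) : Matrix (Fin 3) (Fin 3) (w.1.adicCompletion L))).det := by
      rw [hcoe', Units.val_mul, Units.val_mul]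
      exact Matrix.det_units_conj (y₀ : GL (Fin 3) (w.1.adicCompletion L)) _
    have hτ' := hτ
    rw [hchar, hdet'] at hτ'
    have hdepth : ∀ i k : Fin 3, i ≠ k → Valued.v (ϖ ^ (4 * τ + 10 * ΩM.find (e g))) ≤ Valued.v ((d i : w.1.adicCompletion L) - d k) := fun i k hik =>
      K2E3SplitTorusDepthFromDiscriminant.v_pow_le_v_sub_of_pow_normAbs_le_token hϖ hdm hdm' hτ' hik
    have hlam : lam ≤ 4 * τ + 10 * ΩM.find (e g) := hlam_min _ hdepth
    have hN : (2 * (R g + 42 * ΩM.find (e g) + 2 * mθ + 16 * τ) + 1 : ℕ) ≤ 24 * mθ + 416 * ΩM.find (e g) + 160 * τ + 3 := by rw [hR]; omega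
    have hN' : ((2 * (R g + 42 * ΩM.find (e g) + 2 * mθ + 16 * τ) + 1 : ℕ) : ℝ) ≤ 24 * (mθ : ℝ) + 416 * (ΩM.find (e g) : ℝ) + 160 * (τ : ℝ) + 3 := by
      exact_mod_cast hN
    -- the shell bound (★ FILE A §1)
    have hshell := hC (fun m' => B v₁ (r.ρ (e.symm m') v₁)) hθMc hθ (Real.toNNReal M₀) hMb ⟨t, htT⟩ d hd (e g) y₀ (ΩM.find (e g)) hgm hgy τ hτ (R g)
    rw [← hT] at hshell
    refine hshell.trans ?_
    -- `(N : ℝ) ≤ A₀ · (h + 1) · (1 + |log T|)`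
    set X : ℝ := |Real.log (T (e g) : ℝ)| with hX
    have hX0 : 0 ≤ X := abs_nonneg _
    have hm0 : (0 : ℝ) ≤ (ΩM.find (e g) : ℝ) := Nat.cast_nonneg _
    have hP1 : (1 : ℝ) ≤ ((ΩM.find (e g) : ℝ) + 1) * (1 + X) := one_le_mul_of_one_le_of_one_le (by linarith) (by linarith)
    have hP0 : (0 : ℝ) ≤ ((ΩM.find (e g) : ℝ) + 1) * (1 + X) := zero_le_one.trans hP1
    have hτX : (τ : ℝ) ≤ 1 + X / Real.log ((residueFieldCard (w.1.adicCompletion L) : ℝ≥0) : ℝ) := hτle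
    have hc0 : (0 : ℝ) ≤ 160 / Real.log ((residueFieldCard (w.1.adicCompletion L) : ℝ≥0) : ℝ) := by positivity
    have hNA : ((2 * (R g + 42 * ΩM.find (e g) + 2 * mθ + 16 * τ) + 1 : ℕ) : ℝ) ≤ A₀ * (((ΩM.find (e g) : ℝ) + 1) * (1 + X)) := by
      have h1 : (24 * (mθ : ℝ) + 163) ≤ (24 * (mθ : ℝ) + 163) * (((ΩM.find (e g) : ℝ) + 1) * (1 + X)) := le_mul_of_one_le_right (by positivity) hP1
      have h2 : 416 * (ΩM.find (e g) : ℝ) ≤ 416 * (((ΩM.find (e g) : ℝ) + 1) * (1 + X)) := by nlinarith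
      have h3 : 160 * (τ : ℝ) ≤ 160 + 160 / Real.log ((residueFieldCard (w.1.adicCompletion L) : ℝ≥0) : ℝ) * X := by
        have := mul_le_mul_of_nonneg_left hτX (by norm_num : (0 : ℝ) ≤ 160)
        rw [mul_add, mul_one, mul_div_assoc'] at this
        linarith [this, show 160 * X / Real.log ((residueFieldCard (w.1.adicCompletion L) : ℝ≥0) : ℝ) =
          160 / Real.log ((residueFieldCard (w.1.adicCompletion L) : ℝ≥0) : ℝ) * X by ring]
      have h4 : 160 / Real.log ((residueFieldCard (w.1.adicCompletion L) : ℝ≥0) : ℝ) * X ≤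
          160 / Real.log ((residueFieldCard (w.1.adicCompletion L) : ℝ≥0) : ℝ) * (((ΩM.find (e g) : ℝ) + 1) * (1 + X)) :=
        mul_le_mul_of_nonneg_left (by nlinarith) hc0
      rw [hA₀]
      nlinarith
    -- assemble: `C·Mb·N·q^h·T⁻¹ ≤ K₀·(h+1)·q^h·(T⁻¹(1+|log T|))`
    have hqh : (0 : ℝ) ≤ ((residueFieldCard (w.1.adicCompletion L) : ℝ≥0) : ℝ) ^ (ΩM.find (e g)) := pow_nonneg (zero_le_one.trans hq1.le) _
    have hTinv : (0 : ℝ) ≤ ((T (e g) : ℝ))⁻¹ := inv_nonneg.2 (T (e g)).2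
    calc (C : ℝ) * (Real.toNNReal M₀ : ℝ) * ((2 * (R g + 42 * ΩM.find (e g) + 2 * mθ + 16 * τ) + 1 : ℕ) : ℝ) *
          ((residueFieldCard (w.1.adicCompletion L) : ℝ≥0) : ℝ) ^ (ΩM.find (e g)) * ((T (e g) : ℝ))⁻¹
        ≤ (C : ℝ) * (Real.toNNReal M₀ : ℝ) * (A₀ * (((ΩM.find (e g) : ℝ) + 1) * (1 + X))) *
          ((residueFieldCard (w.1.adicCompletion L) : ℝ≥0) : ℝ) ^ (ΩM.find (e g)) * ((T (e g) : ℝ))⁻¹ :=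
          mul_le_mul_of_nonneg_right (mul_le_mul_of_nonneg_right (mul_le_mul_of_nonneg_left hNA hCM0) hqh) hTinv
      _ = ((C : ℝ) * (Real.toNNReal M₀ : ℝ) * A₀) * (((ΩM.find (e g) : ℝ) + 1) * ((residueFieldCard (w.1.adicCompletion L) : ℝ≥0) : ℝ) ^ (ΩM.find (e g)) *
          (((T (e g) : ℝ))⁻¹ * (1 + X) ^ 1)) := by ring
      _ ≤ K₀ * (((ΩM.find (e g) : ℝ) + 1) * ((residueFieldCard (w.1.adicCompletion L) : ℝ≥0) : ℝ) ^ (ΩM.find (e g)) *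
          (((T (e g) : ℝ))⁻¹ * (1 + X) ^ 1)) :=
          mul_le_mul_of_nonneg_right hK₀ge' (mul_nonneg (mul_nonneg (by linarith) hqh) (mul_nonneg hTinv (by rw [pow_one]; linarith)))
      _ ≤ K₀ * (((ΩM.find (e g) : ℝ) + 1) * ((residueFieldCard (w.1.adicCompletion L) : ℝ≥0) : ℝ) ^ (ΩM.find (e g)) *
          (((T (e g) : ℝ))⁻¹ * (1 + X) ^ 1)) + (Real.toNNReal M₀ : ℝ) * WE (e g) := le_add_of_nonneg_right (mul_nonneg (Real.toNNReal M₀).2 (hWE0 _))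
      _ = W_M (e g) := by rw [hW_M, hX]; ring
  -- `hball`, `hballE` through the two reductions of ★ FILE B, then ★ p856355
  have hballE := hballER W_M (by
    filter_upwards [hregae] with g hreg hell'
    exact (hell g hreg ((K2E3TruncatedCharTransport.isCompact_centralizer_iff_of_continuousMulEquiv e g).1 hell'.2)).2)
  have hball := hballR W_M (by
    filter_upwards [hregae] with g hreg hng
    by_cases hZ : IsCompact ((Subgroup.centralizer ({g} : Set ((UnitaryGroup.cmDatum L 3 H).Local v))) : Set ((UnitaryGroup.cmDatum L 3 H).Local v))
    · obtain ⟨hint, hle⟩ := hell g hreg ((K2E3TruncatedCharTransport.isCompact_centralizer_iff_of_continuousMulEquiv e g).1 hZ)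
      exact (setIntegral_le_integral hint.norm (Eventually.of_forall fun x => norm_nonneg _)).trans hle
    · exact hsplit g hreg hZ)
  exact K2E3SupercuspidalTruncatedCharDominationOfBricks.sigSCan_datum_of_bricks L 3 H hH hdet v hns μ r hsc B hBinv v₁ Ω F hlim Bset hBsetc hcanc
    (fun g => W_M (e g)) hballE hball hW

/-! ## §2 The head: the (SC-an) datum at `N = 3` modulo «ELL-WEIGHT» AT THE PLACE -/
set_option maxHeartbeats 800000 in -- long statement (the ∀-closed letter as a binder) on the CM ∕ one-place carriers
/-- **(M5h‴) HEAD — THE (SC-an) ∃-DATUM FOR A SUPERCUSPIDAL `SmoothIrrep` OF `U₃(H)(L⁺_v)` AT A NON-SPLIT PLACE, MODULO «ELL-WEIGHT» AT THE PLACE (letter-neutral docking).**  For EVERY hermitian `H ∈ M₃(L)` with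
`det H ≠ 0`, `v` non-split, every Haar `μ` on `G = (cmDatum L 3 H).Local v`, every supercuspidal `SmoothIrrep r` with invariant `B`, and `v₁ : r.V`:
`∃ Ω F M, (SC-lim∖ell) ∧ (SC-dom) ∧ M ∈ L¹_loc(μ)` — EXACTLY the `hSC`-tail of ★ p856184 `charLocIntNearSemisimple_supercuspidal_of_exists_truncated` ∕ the consequent of ★ p856355
`sigSCan_datum_of_bricks` at `N = 3`, hence (with those) Harish-Chandra's Theorem 16 «the character of a supercuspidal class is a locally summable function» for `U₃(H)(L⁺_v)`,
MODULO the ONE named input `hEW` = «ELL-WEIGHT» AT THE PLACE (a locally integrable weight dominating the elliptic orbital integrals on `U(σ_w, Φ₃)(L_w)`; paid by «HC-14-ell» = Theorem 14, road A, or by (FC), road FC).  Dichotomy ★ (f2)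
`isotropic_or_anisotropic`: §1 (anisotropic, letter-free) ∕ §2 (isotropic, along ★ (f2)'s field model).
[cite: HarishChandra1970, Part VII §3 Theorem 16 p. 67, pp. 70–73; Part VI §8 Theorem 14 p. 60; §2 Theorems 18–20 pp. 69–70] [cite: Rogawski1990, §12.2 p. 173, §12.5 p. 182, §14.2 p. 232] -/
theorem sigSCan_datum_of_ellWeightPlace
    (hEW : ∀ (L' : Type) [Field L'] [NumberField L'] [IsCMField L'] {v' : HeightOneSpectrum (𝓞 ↥(maximalRealSubfield L'))}
      (w' : UnitaryGroup.PlacesOver L' v') (hw' : IsCMField.complexConj L' • w'.1 = w'.1)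
      [MeasurableSpace ↥(unitaryGroupOfForm (galAdicCompletionMap (L := L') (IsCMField.complexConj L') hw') ((StdForm.antidiagonal 3).over (w'.1.adicCompletion L')))]
      [BorelSpace ↥(unitaryGroupOfForm (galAdicCompletionMap (L := L') (IsCMField.complexConj L') hw') ((StdForm.antidiagonal 3).over (w'.1.adicCompletion L')))]
      (μ' : Measure ↥(unitaryGroupOfForm (galAdicCompletionMap (L := L') (IsCMField.complexConj L') hw') ((StdForm.antidiagonal 3).over (w'.1.adicCompletion L')))) [μ'.IsHaarMeasure]
      {S : Set ↥(unitaryGroupOfForm (galAdicCompletionMap (L := L') (IsCMField.complexConj L') hw') ((StdForm.antidiagonal 3).over (w'.1.adicCompletion L')))} (_ : IsCompact S),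
      ∃ W_E : ↥(unitaryGroupOfForm (galAdicCompletionMap (L := L') (IsCMField.complexConj L') hw') ((StdForm.antidiagonal 3).over (w'.1.adicCompletion L'))) → ℝ,
        LocallyIntegrable W_E μ' ∧ (∀ g, 0 ≤ W_E g) ∧
        ∀ γ : ↥(unitaryGroupOfForm (galAdicCompletionMap (L := L') (IsCMField.complexConj L') hw') ((StdForm.antidiagonal 3).over (w'.1.adicCompletion L'))),
          IsRegularElt (γ : GL (Fin 3) (w'.1.adicCompletion L')) →
          IsCompact ((Subgroup.centralizer ({γ} : Set ↥(unitaryGroupOfForm (galAdicCompletionMap (L := L') (IsCMField.complexConj L') hw') ((StdForm.antidiagonal 3).over (w'.1.adicCompletion L'))))) :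
              Set ↥(unitaryGroupOfForm (galAdicCompletionMap (L := L') (IsCMField.complexConj L') hw') ((StdForm.antidiagonal 3).over (w'.1.adicCompletion L')))) →
            ∀ Θ : ↥(unitaryGroupOfForm (galAdicCompletionMap (L := L') (IsCMField.complexConj L') hw') ((StdForm.antidiagonal 3).over (w'.1.adicCompletion L'))) → ℝ≥0∞,
              Measurable Θ → (∀ g, Θ g ≠ 0 → g ∈ S) → ∀ Mb : ℝ≥0∞, (∀ g, Θ g ≤ Mb) →
                ∫⁻ x, Θ (x * γ * x⁻¹) ∂μ' ≤ ENNReal.ofReal (W_E γ) * Mb)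
    (hH : (H.map (cmConjRingHom L))ᵀ = H) (hdet : H.det ≠ 0)
    (v : HeightOneSpectrum (𝓞 ↥(maximalRealSubfield L))) (hns : ∀ w : PlacesOver L v, IsCMField.complexConj L • w.1 = w.1)
    [MeasurableSpace ((UnitaryGroup.cmDatum L 3 H).Local v)] [BorelSpace ((UnitaryGroup.cmDatum L 3 H).Local v)]
    (μ : Measure ((UnitaryGroup.cmDatum L 3 H).Local v)) [μ.IsHaarMeasure]
    (r : SmoothIrrep ((UnitaryGroup.cmDatum L 3 H).Local v)) (hsc : r.ρ.IsSupercuspidal)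
    (B : r.V →ₗ⋆[ℂ] r.V →ₗ[ℂ] ℂ) (hBinv : ∀ (g : (UnitaryGroup.cmDatum L 3 H).Local v) (x y : r.V), B (r.ρ g x) (r.ρ g y) = B x y) (v₁ : r.V) :
    ∃ (Ω' : CompactExhaustion ((UnitaryGroup.cmDatum L 3 H).Local v))
      (F' : (UnitaryGroup.cmDatum L 3 H).Local v → ℂ) (M : (UnitaryGroup.cmDatum L 3 H).Local v → ℝ),
      (∀ᵐ g ∂μ, ¬ (IsRegularElt (g.val : GL (Fin 3) (UnitaryGroup.LocalRing L v)) ∧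
          IsCompact ((Subgroup.centralizer ({g} : Set ((UnitaryGroup.cmDatum L 3 H).Local v))) : Set ((UnitaryGroup.cmDatum L 3 H).Local v))) →
        Tendsto (fun n => ∫ x in Ω' n, B v₁ (r.ρ (x * g * x⁻¹) v₁) ∂μ) atTop (𝓝 (F' g))) ∧
      (∀ n : ℕ, ∀ᵐ g ∂μ, ‖∫ x in Ω' n, B v₁ (r.ρ (x * g * x⁻¹) v₁) ∂μ‖ ≤ M g) ∧
      LocallyIntegrable M μ := by
  obtain ⟨w⟩ := (inferInstance : Nonempty (PlacesOver L v))
  have hw : IsCMField.complexConj L • w.1 = w.1 := hns w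
  rcases K2E3RankOneIsotropicPhi3Model.isotropic_or_anisotropic (σ := galAdicCompletionMap (L := L) (IsCMField.complexConj L) hw) (placeForm H w.1) with hiso | hanis
  · obtain ⟨e⟩ := K2E3RankOneIsotropicPhi3Model.nonempty_continuousMulEquiv_cmLocal_fieldModel_of_isotropic L H hH (isUnit_iff_ne_zero.2 hdet) w hw hiso
    exact sigSCan_datum_of_ellWeightPlace_of_fieldModel L H hEW hH hdet v hns w hw μ e r hsc B hBinv v₁
  · haveI : CompactSpace ((UnitaryGroup.cmDatum L 3 H).Local v) :=
      compactSpace_local_of_anisotropic (IsCMField.complexConj L) H v w hw (IsCMField.complexConj_ne_one L) hanis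
    exact K2E3SupercuspidalTruncatedCharAnalyticOfHC14Ell.sigSCan_datum_of_compactSpace L H hH hdet v hns μ r hsc B hBinv v₁


end Summit.HodgeConjecture.HodgeConjecture.Cruxes.H413.K2E3SupercuspidalTruncatedCharAnalyticOfEllWeightPlace

end
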